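import Summits.KontsevichZagierPeriods.KontsevichZagierPeriods.Theorems.RootDecompRationalCubeDichotomyNashMultiGenP13

/-! # `RootDecompRationalCubeDichotomyNashMultiGenP14` — part 14/16 of the mechanical ≤385-line split of `NashEtaleMultiGen.lean`
(split by the decomp-kz census seat for landing; mathematics unchanged; part 14 continues part 13). -/

open Set MvPolynomial Filter Topology
open Literature.NumberTheory.Transcendental (IsSemialgebraicFunOn)
open Literature.ModelTheory.ExponentialFields (IsSemialgebraic isSemialgebraic_setOf_eval_pos
  isSemialgebraic_setOf_eval_ne_zero)

namespace Summit.KontsevichZagierPeriods.RootDecompRationalCubeDichotomy.Rung29430.MultiGen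
open Summit.KontsevichZagierPeriods.KontsevichZagierPeriods.Theses.RootDecompRationalCubeDichotomy
  (NashEtaleCover NashEtaleLocal PiRationalisation)
open Summit.KontsevichZagierPeriods.RootDecompRationalCubeDichotomy.Rung29430.NashEtaleLocalGlue
  (local_of_simple nashEtaleCover_of_nashEtaleLocal nashEtaleLocal_zero)
open Summit.KontsevichZagierPeriods.RootDecompRationalCubeDichotomy.Rung29430.NashEtaleLocalOne
  (analyticOnNhd_aeval_snoc)
open Summit.KontsevichZagierPeriods.RootDecompRationalCubeDichotomy.RungEtale.Etale
  (piRationalisation_of_nashEtaleCover)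

noncomputable section

namespace NashImplicitK
open Literature.NumberTheory.Transcendental Literature.ModelTheory.ExponentialFields
variable {K : Type} [CommRing K] [Algebra K ℝ]
variable {n k : ℕ}

/-- **Local uniqueness of solutions.**  Two families of solutions of the étale system through
`y₀`, continuous at `x₀`, agree on a neighbourhood of `x₀`. -/
theorem solutions_eq_near (F : Fin k → MvPolynomial (Fin (n + k)) K) (x₀ : Fin n → ℝ)
    (y₀ : Fin k → ℝ)
    (hJ : (Matrix.of fun i j : Fin k =>
      MvPolynomial.aeval (Fin.append x₀ y₀) (pderiv (Fin.natAdd n j) (F i))).det ≠ 0)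
    {V : Set (Fin n → ℝ)} (hV : IsOpen V) (hx₀ : x₀ ∈ V) {u v : Fin k → (Fin n → ℝ) → ℝ}
    (hu₀ : ∀ j, u j x₀ = y₀ j) (hv₀ : ∀ j, v j x₀ = y₀ j)
    (huc : ∀ j, ContinuousAt (u j) x₀) (hvc : ∀ j, ContinuousAt (v j) x₀)
    (hFu : ∀ x ∈ V, ∀ i, MvPolynomial.aeval (Fin.append x fun j => u j x) (F i) = 0)
    (hFv : ∀ x ∈ V, ∀ i, MvPolynomial.aeval (Fin.append x fun j => v j x) (F i) = 0) :
    ∃ W : Set (Fin n → ℝ), IsOpen W ∧ x₀ ∈ W ∧ W ⊆ V ∧ ∀ x ∈ W, ∀ j, u j x = v j x := by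
  classical
  have hJ' : (Jy F (Fin.append x₀ y₀)).det ≠ 0 := hJ
  have hRcoe : ⇑(locHomeo F _ hJ') = Psi F := locHomeo_coe F _ hJ'
  have hz₀R : Fin.append x₀ y₀ ∈ (locHomeo F _ hJ').source := mem_locHomeo_source F _ hJ'
  -- the two graph maps are continuous at `x₀` with value `(x₀, y₀)`
  have hcont : ∀ w : Fin k → (Fin n → ℝ) → ℝ, (∀ j, ContinuousAt (w j) x₀) →
      ContinuousAt (fun x => Fin.append x fun j => w j x) x₀ := by
    intro w hw
    refine continuousAt_pi.2 fun r => ?_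
    induction r using Fin.addCases with
    | left i =>
      simp only [Fin.append_left]
      exact (continuous_apply i).continuousAt
    | right j =>
      simp only [Fin.append_right]
      exact hw j
  have hval : ∀ w : Fin k → (Fin n → ℝ) → ℝ, (∀ j, w j x₀ = y₀ j) →
      (Fin.append x₀ fun j => w j x₀) = Fin.append x₀ y₀ := by
    intro w hw
    congr 1
    funext j
    exact hw j
  have hpre : ∀ w : Fin k → (Fin n → ℝ) → ℝ, (∀ j, ContinuousAt (w j) x₀) → (∀ j, w j x₀ = y₀ j) →
      (fun x => Fin.append x fun j => w j x) ⁻¹' (locHomeo F _ hJ').source ∈ nhds x₀ := by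
    intro w hw hw₀
    apply (hcont w hw).preimage_mem_nhds
    rw [hval w hw₀]
    exact (locHomeo F _ hJ').open_source.mem_nhds hz₀R
  obtain ⟨W, hWsub, hWo, hx₀W⟩ := mem_nhds_iff.mp
    (Filter.inter_mem (hV.mem_nhds hx₀) (Filter.inter_mem (hpre u huc hu₀) (hpre v hvc hv₀)))
  refine ⟨W, hWo, hx₀W, fun x hx => (hWsub hx).1, fun x hx j => ?_⟩
  have hxV : x ∈ V := (hWsub hx).1
  have hsu : (Fin.append x fun j => u j x) ∈ (locHomeo F _ hJ').source := (hWsub hx).2.1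
  have hsv : (Fin.append x fun j => v j x) ∈ (locHomeo F _ hJ').source := (hWsub hx).2.2
  have h1 : Psi F (Fin.append x fun j => u j x) = emb0 k x := by
    rw [Psi_eq_emb0 F (hFu x hxV)]
    congr 1
    funext i
    simp
  have h2 : Psi F (Fin.append x fun j => v j x) = emb0 k x := by
    rw [Psi_eq_emb0 F (hFv x hxV)]
    congr 1
    funext i
    simp
  have heq := (locHomeo F _ hJ').injOn hsu hsv (by rw [hRcoe, h1, h2])
  have := congrFun heq (Fin.natAdd n j)
  simpa only [Fin.append_right] using this

end NashImplicitK

/-! ### §6.7  The residual in EXISTENCE form (one identified analytic solution suffices) — the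
shape in which the literature states it (Artin–Mazur / BCR 8.1: a Nash germ is a coordinate of an
analytic branch of an étale `K`-scheme over affine space). PROVED: `OriginNash d ↔ OriginNashExists d`. -/

section OriginExists

open Literature.NumberTheory.Transcendental Literature.ModelTheory.ExponentialFields

/-- `K`-étale point data at the origin, EXISTENCE form: an étale `K`-polynomial system with a real
point `y₀` over `t = 0`, ONE analytic solution `u` through `y₀` near `0`, and `G = A/B(t, u t)`
near `0`. -/
def OriginPointDataExists (K : Type) [CommRing K] [Algebra K ℝ] (d : ℕ) (G : (Fin d → ℝ) → ℝ) :
    Prop :=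
  ∃ (k : ℕ) (y₀ : Fin k → ℝ) (F : Fin k → MvPolynomial (Fin (d + k)) K)
    (A B : MvPolynomial (Fin (d + k)) K),
    (∀ i, MvPolynomial.aeval (Fin.append (0 : Fin d → ℝ) y₀) (F i) = 0) ∧
    (Matrix.of fun i j : Fin k =>
      MvPolynomial.aeval (Fin.append (0 : Fin d → ℝ) y₀) (pderiv (Fin.natAdd d j) (F i))).det ≠ 0 ∧
    MvPolynomial.aeval (Fin.append (0 : Fin d → ℝ) y₀) B ≠ 0 ∧
    ∃ (V : Set (Fin d → ℝ)) (u : Fin k → (Fin d → ℝ) → ℝ), IsOpen V ∧ (0 : Fin d → ℝ) ∈ V ∧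
      (∀ j, u j 0 = y₀ j) ∧ (∀ j, AnalyticOnNhd ℝ (u j) V) ∧
      (∀ t ∈ V, ∀ i, MvPolynomial.aeval (Fin.append t fun j => u j t) (F i) = 0) ∧
      ∀ t ∈ V, G t = MvPolynomial.aeval (Fin.append t fun j => u j t) A /
        MvPolynomial.aeval (Fin.append t fun j => u j t) B

/-- `OriginNash` in existence form. -/
def OriginNashExists (d : ℕ) : Prop :=
  ∀ (K : Type) [CommRing K] [Algebra K ℝ] (G : (Fin d → ℝ) → ℝ) (U : Set (Fin d → ℝ)),
    IsOpen U → (0 : Fin d → ℝ) ∈ U → IsSemialgebraicFunOn K U G → AnalyticOnNhd ℝ G U →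
    OriginPointDataExists K d G

variable {K : Type} [CommRing K] [Algebra K ℝ] {d : ℕ} {G : (Fin d → ℝ) → ℝ}

/-- Existence of ONE identified analytic solution gives the point data (identification along
EVERY analytic solution), by local uniqueness of solutions of the étale system. -/
theorem originPointData_of_exists (h : OriginPointDataExists K d G) : OriginPointData K d G := by
  obtain ⟨k, y₀, F, A, B, hF0, hJ, hB, V, u, hVo, h0V, hu0, huan, hFu, hG⟩ := h
  refine ⟨k, y₀, F, A, B, hF0, hJ, hB, fun V' u' hV'o h0V' hu'0 hu'an hFu' => ?_⟩
  obtain ⟨W, hWo, h0W, hWsub, hW⟩ := NashImplicitK.solutions_eq_near F 0 y₀ hJ (hVo.inter hV'o)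
    ⟨h0V, h0V'⟩ hu0 hu'0 (fun j => (huan j 0 h0V).continuousAt)
    (fun j => (hu'an j 0 h0V').continuousAt) (fun t ht => hFu t ht.1) (fun t ht => hFu' t ht.2)
  refine ⟨W, fun t ht => (hWsub ht).2, hWo, h0W, fun t ht => ?_⟩
  have hu_eq : (fun j => u j t) = fun j => u' j t := funext fun j => hW t ht j
  rw [hG t (hWsub ht).1, hu_eq]

/-- Conversely the point data give an identified analytic solution (analytic implicit functions,
§6.6). -/
theorem exists_of_originPointData (h : OriginPointData K d G) : OriginPointDataExists K d G := by
  obtain ⟨k, y₀, F, A, B, hF0, hJ, hB, hall⟩ := h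
  obtain ⟨V, u, hVo, h0V, hu0, huan, hFu⟩ := NashImplicitK.exists_implicit F 0 y₀ hF0 hJ
  obtain ⟨W, hWV, hWo, h0W, hG⟩ := hall V u hVo h0V hu0 huan hFu
  exact ⟨k, y₀, F, A, B, hF0, hJ, hB, W, u, hWo, h0W, hu0, fun j t ht => huan j t (hWV ht),
    fun t ht => hFu t (hWV ht), hG⟩

/-- Auxiliary step `originPointData_iff_exists`. [bookkeeping] -/
theorem originPointData_iff_exists : OriginPointData K d G ↔ OriginPointDataExists K d G :=
  ⟨exists_of_originPointData, originPointData_of_exists⟩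

/-- Auxiliary step `originNash_iff_exists`. [bookkeeping] -/
theorem originNash_iff_exists {d : ℕ} : OriginNash d ↔ OriginNashExists d := by
  constructor
  · intro h K _ _ G U hU h0 hsa han
    exact exists_of_originPointData (h K G U hU h0 hsa han)
  · intro h K _ _ G U hU h0 hsa han
    exact originPointData_of_exists (h K G U hU h0 hsa han)

/-- **NET (v6).**  Item 31659 from the residual in existence form. -/
theorem nashEtaleLocal_of_originNashExists (hO : ∀ d, 1 ≤ d → OriginNashExists d) :
    NashEtaleLocal :=
  nashEtaleLocal_of_originNash fun d hd => originNash_iff_exists.mpr (hO d hd)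

/-- Auxiliary step `piRationalisation_of_originNashExists`. [bookkeeping] -/
theorem piRationalisation_of_originNashExists (hO : ∀ d, 1 ≤ d → OriginNashExists d) :
    PiRationalisation :=
  piRationalisation_of_originNash fun d hd => originNash_iff_exists.mpr (hO d hd)

/-- **The UNRAMIFIED case of the residual** (every `d`, every coefficient ring `K`): if `G`
satisfies near `0` a `K`-polynomial relation `P(t, G t) = 0` which is SIMPLE at `(0, G 0)`
(`∂P/∂w ≠ 0` there), then `OriginPointData K d G` — one unknown, `F = P`, `A = w`, `B = 1`; the
identification along every analytic solution is the local uniqueness of §6.6.  What remains of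
`OriginNash d` is the RAMIFIED case (Tougeron–Nagata truncation / Artin–Mazur). -/
theorem originPointData_of_simple {U : Set (Fin d → ℝ)} (hU : IsOpen U) (h0 : (0 : Fin d → ℝ) ∈ U)
    (han : AnalyticOnNhd ℝ G U) (P : MvPolynomial (Fin (d + 1)) K)
    (hP : ∀ t ∈ U, MvPolynomial.aeval (Fin.append t (fun _ : Fin 1 => G t)) P = 0)
    (hP' : MvPolynomial.aeval (Fin.append (0 : Fin d → ℝ) (fun _ : Fin 1 => G 0))
      (pderiv (Fin.natAdd d 0) P) ≠ 0) :
    OriginPointData K d G := by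
  classical
  apply originPointData_of_exists
  refine ⟨1, fun _ => G 0, fun _ => P, X (Fin.natAdd d 0), 1, fun _ => hP 0 h0, ?_, by simp,
    U, fun _ => G, hU, h0, fun _ => rfl, fun _ => han, fun t ht _ => hP t ht, fun t _ => ?_⟩
  · rw [Matrix.det_unique]
    simpa using hP'
  · simp

end OriginExists

/-! ### §6.8  Corollaries for the BORN items 33041 `MultiGenDefectOne` and 33042 `MultiGenSpecial`
(route file rev ≥ 10).  The farm snapshot serving this file's imports predates the items, so they are
mirrored here VERBATIM (`Item33041`, `Item33042` = the δ-expanded route decls, copied byte-for-byte from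
`Theses/RootDecompRationalCubeDichotomy.lean`); against the live route file
`example : MultiGenDefectOne ↔ Item33041 := Iff.rfl` (writer g5 a5/deltaB.lean did this check). -/

section BornItems

/-- VERBATIM mirror of item 33041 `Theses.RootDecompRationalCubeDichotomy.MultiGenDefectOne`. -/
def Item33041 : Prop :=
  ∀ (n : ℕ), 1 ≤ n → ∀ (g : (Fin n → ℝ) → ℝ) (U : Set (Fin n → ℝ)), IsOpen U → Set.pi Set.univ (fun _ : Fin n => Set.Icc (0:ℝ) 1) ⊆ U → Literature.NumberTheory.Transcendental.IsSemialgebraicFunOn ℚ U g → AnalyticOnNhd ℝ g U → ∀ x₀ ∈ Set.pi Set.univ (fun _ : Fin n => Set.Icc (0:ℝ) 1), ¬ AlgebraicIndependent ℚ x₀ → (∃ i : Fin n, AlgebraicIndependent ℚ (fun j : {j : Fin n // j ≠ i} => x₀ (j : Fin n))) → ∃ k : ℕ, ∃ (V : Set (Fin n → ℝ)) (u : Fin k → (Fin n → ℝ) → ℝ) (F : Fin k → MvPolynomial (Fin (n + k)) ℚ) (A B : MvPolynomial (Fin (n + k)) ℚ), IsOpen V ∧ x₀ ∈ V ∧ (∀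 j, Literature.NumberTheory.Transcendental.IsSemialgebraicFunOn ℚ V (u j)) ∧ (∀ j, AnalyticOnNhd ℝ (u j) V) ∧ (∀ x ∈ V, ∀ i, MvPolynomial.aeval (Fin.append x (fun j => u j x) : Fin (n + k) → ℝ) (F i) = 0) ∧ (Matrix.of fun i j : Fin k => MvPolynomial.aeval (Fin.append x₀ (fun j => u j x₀) : Fin (n + k) → ℝ) (MvPolynomial.pderiv (Fin.natAdd n j) (F i))).det ≠ 0 ∧ (∀ x ∈ V, MvPolynomial.aeval (Fin.append x (fun j => u j x) : Fin (n + k) → ℝ) B ≠ 0 ∧ g x = MvPolynomial.aeval (Fin.append x (fun j => u j x) : Fin (n + k) → ℝ) A / MvPolynomial.aeval (Fin.append x (fun j => u j x) : Fin (n + k) → ℝ) B)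

/-- VERBATIM mirror of item 33042 `Theses.RootDecompRationalCubeDichotomy.MultiGenSpecial`. -/
def Item33042 : Prop :=
  ∀ (n : ℕ), 2 ≤ n → ∀ (g : (Fin n → ℝ) → ℝ) (U : Set (Fin n → ℝ)), IsOpen U → Set.pi Set.univ (fun _ : Fin n => Set.Icc (0:ℝ) 1) ⊆ U → Literature.NumberTheory.Transcendental.IsSemialgebraicFunOn ℚ U g → AnalyticOnNhd ℝ g U → ∀ x₀ ∈ Set.pi Set.univ (fun _ : Fin n => Set.Icc (0:ℝ) 1), ¬ (∃ i : Fin n, AlgebraicIndependent ℚ (fun j : {j : Fin n // j ≠ i} => x₀ (j : Fin n))) → ∃ k : ℕ, ∃ (V : Set (Fin n → ℝ)) (u : Fin k → (Fin n → ℝ) → ℝ) (F : Fin k → MvPolynomial (Fin (n + k)) ℚ) (A B : MvPolynomial (Fin (n + k)) ℚ), IsOpen V ∧ x₀ ∈ V ∧ (∀ j, Literature.NumberTheory.Transcendental.IsSemialgebraicFunOn ℚ V (u j)) ∧ (∀ j, AnalyticOnNhd ℝ (u j) V) ∧ (∀ x ∈ V, ∀ i, MvPolynomial.aeval (Fin.append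 x (fun j => u j x) : Fin (n + k) → ℝ) (F i) = 0) ∧ (Matrix.of fun i j : Fin k => MvPolynomial.aeval (Fin.append x₀ (fun j => u j x₀) : Fin (n + k) → ℝ) (MvPolynomial.pderiv (Fin.natAdd n j) (F i))).det ≠ 0 ∧ (∀ x ∈ V, MvPolynomial.aeval (Fin.append x (fun j => u j x) : Fin (n + k) → ℝ) B ≠ 0 ∧ g x = MvPolynomial.aeval (Fin.append x (fun j => u j x) : Fin (n + k) → ℝ) A / MvPolynomial.aeval (Fin.append x (fun j => u j x) : Fin (n + k) → ℝ) B)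

/-- Item 33041 is `∀ n ≥ 1, MultiGenDefectOneAt n` (definitional). -/
theorem item33041_iff : Item33041 ↔ ∀ n, 1 ≤ n → MultiGenDefectOneAt n := Iff.rfl

/-- Item 33042 is `∀ n ≥ 2, MultiGenSpecialAt n` (definitional). -/
theorem item33042_iff : Item33042 ↔ ∀ n, 2 ≤ n → MultiGenSpecialAt n := Iff.rfl

/-- The edge of the born pair: items 33041 ∧ 33042 ⟹ item 31659 (hence 29430, 24903). -/
theorem nashEtaleLocal_of_items (h₁ : Item33041) (h₂ : Item33042) : NashEtaleLocal :=
  nashEtaleLocal_of_strata (item33041_iff.mp h₁) (item33042_iff.mp h₂)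

/-- Auxiliary step `piRationalisation_of_items`. [bookkeeping] -/
theorem piRationalisation_of_items (h₁ : Item33041) (h₂ : Item33042) : PiRationalisation :=
  piRationalisation_of_strata (item33041_iff.mp h₁) (item33042_iff.mp h₂)

/-- Converse edges: item 31659 ⟹ items 33041 and 33042 (the pair is JOINTLY equivalent to 31659). -/
theorem item33041_of_nashEtaleLocal (h : NashEtaleLocal) : Item33041 :=
  item33041_iff.mpr fun n _ =>
    multiGenDefectOneAt_of_multiGenAt (multiGenAt_of_nashEtaleLocalAt (nashEtaleLocal_iff.mp h n))

/-- Auxiliary step `item33042_of_nashEtaleLocal`. [bookkeeping] -/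
theorem item33042_of_nashEtaleLocal (h : NashEtaleLocal) : Item33042 :=
  item33042_iff.mpr fun n _ =>
    multiGenSpecialAt_of_multiGenAt (multiGenAt_of_nashEtaleLocalAt (nashEtaleLocal_iff.mp h n))

/-- **Item 33041 (the defect-1 stratum, every dimension) from `OriginNash 1`** — one-variable
`K`-Nash germs at the origin, any coefficient ring `K → ℝ` (§6.5). -/
theorem item33041_of_originNash_one (hO : OriginNash 1) : Item33041 :=
  item33041_iff.mpr fun _ _ => multiGenDefectOneAt_of_originNash_one hO

/-- **Item 33041 from the SLICE residual `SliceNash 1`** (pure `ℚ`: slice germs `t ↦ g(s₀, t)` of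
`ℚ`-Nash functions at product points `(s₀, 0)`, ONE special coordinate). -/
theorem item33041_of_sliceNash_one (hS : SliceNash 1) : Item33041 :=
  item33041_iff.mpr fun _ _ => multiGenDefectOneAt_of_sliceNash_one hS

/-- Item 33042 from `SliceNash d`, `d ≥ 1`. -/
theorem item33042_of_sliceNash (hS : ∀ d, 1 ≤ d → SliceNash d) : Item33042 :=
  item33042_iff.mpr fun n _ =>
    multiGenSpecialAt_of_multiGenAt (multiGenAt_of_sliceNash (n := n) fun d hd _ => hS d hd)

/-- Auxiliary step `item33041_of_originNashExists_one`. [bookkeeping] -/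
theorem item33041_of_originNashExists_one (hO : OriginNashExists 1) : Item33041 :=
  item33041_of_originNash_one (originNash_iff_exists.mpr hO)

/-- Item 33042 from `OriginNash d`, `d ≥ 1` (§6.4). -/
theorem item33042_of_originNash (hO : ∀ d, 1 ≤ d → OriginNash d) : Item33042 :=
  item33042_iff.mpr fun n _ =>
    multiGenSpecialAt_of_multiGenAt (multiGenAt_of_originNash (n := n) fun d hd _ => hO d hd)

/-- Item 31659 from `OriginNash 1` and item 33042. -/
theorem nashEtaleLocal_of_originNash_one_of_item (hO : OriginNash 1) (h₂ : Item33042) :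
    NashEtaleLocal :=
  nashEtaleLocal_of_items (item33041_of_originNash_one hO) h₂

end BornItems

/-! ### §6.9  The special stratum (defect `≥ 2`) needs only `SliceNash d` for `d ≥ 2` (critic's
REQUEST (ii), 13:48Z): at a point with `¬ DefectLeOne x₀` the generic chart has codimension
`d = n − m ≥ 2` (codimension `0` is the generic branch, codimension `1` would be `DefectLeOne`). -/

section SpecialGeTwo

open Literature.NumberTheory.Transcendental Literature.ModelTheory.ExponentialFields

/-- An injective `e : Fin m → Fin (m + 1)` with `x₀ ∘ e` algebraically independent exhibits
`DefectLeOne x₀` (the missed index is the dropped coordinate). -/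
theorem defectLeOne_of_codim_one {m : ℕ} (x₀ : Fin (m + 1) → ℝ) (e : Fin m → Fin (m + 1))
    (he : Function.Injective e) (hind : AlgebraicIndependent ℚ (x₀ ∘ e)) : DefectLeOne x₀ := by
  classical
  -- the missed index
  have hne : Finset.univ.image e ≠ (Finset.univ : Finset (Fin (m + 1))) := by
    intro h
    have := congrArg Finset.card h
    rw [Finset.card_image_of_injective _ he] at this
    simp at this
  obtain ⟨i, hi⟩ : ∃ i, i ∉ Finset.univ.image e := by
    by_contra h
    push Not at h
    exact hne (Finset.eq_univ_of_forall h)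
  -- every other index is hit
  have hcov : ∀ j : Fin (m + 1), j ≠ i → ∃ l, e l = j := by
    intro j hji
    by_contra hj
    push Not at hj
    have hj' : j ∉ Finset.univ.image e := by
      simpa [Finset.mem_image] using hj
    have hi' : i ∉ insert j (Finset.univ.image e) := by
      simp only [Finset.mem_insert, not_or]
      exact ⟨fun h => hji h.symm, hi⟩
    have hcard := Finset.card_le_card (Finset.subset_univ (insert i (insert j (Finset.univ.image e))))
    rw [Finset.card_insert_of_notMem hi', Finset.card_insert_of_notMem hj',
      Finset.card_image_of_injective _ he] at hcard
    simp at hcard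
  choose l hl using hcov
  let φ : {j : Fin (m + 1) // j ≠ i} → Fin m := fun j => l j j.2
  have hφ : Function.Injective φ := by
    intro a b h
    apply Subtype.ext
    rw [← hl a a.2, ← hl b b.2]
    exact congrArg e h
  have heq : (fun j : {j : Fin (m + 1) // j ≠ i} => x₀ (j : Fin (m + 1))) = (x₀ ∘ e) ∘ φ := by
    funext j
    simp [φ, hl]
  exact ⟨i, by rw [heq]; exact hind.comp φ hφ⟩

/-- **At a point of defect `≥ 2`, piece M (germ form) follows from `SliceNash d`, `2 ≤ d ≤ n`.** -/
theorem nashGermMultiGen_of_sliceNash_geTwo {n : ℕ} (hS : ∀ d, 2 ≤ d → d ≤ n → SliceNash d)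
    (x₀ : Fin n → ℝ) (hnot : ¬ DefectLeOne x₀) : NashGermMultiGen n x₀ := by
  classical
  intro g U hU hx₀U hsa han
  obtain ⟨m, e, T, he, hind, hTe, hT⟩ := exists_generic_chart x₀
  have hdet := det_chart_ne_zero x₀ e T hTe (fun j hj => ⟨(hT j hj).2.1, (hT j hj).2.2⟩)
  obtain ⟨V, ψ, hVo, hy₀V, hψ₀, hψsa, hψan, hψ⟩ := exists_chart_inverse x₀ T hdet
  obtain ⟨W, hWo, hx₀W, -, hleft⟩ := chart_leftInverse_near x₀ T hdet hVo hy₀V hψ₀ hψan hψ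
  have hψv_cont : ContinuousOn (fun y j => ψ j y) V :=
    continuousOn_pi.2 fun j => (hψan j).continuousOn
  have hψv₀ : (fun j => ψ j (chartMap T x₀)) = x₀ := funext hψ₀
  have hO : IsOpen (V ∩ (fun y j => ψ j y) ⁻¹' U) := hψv_cont.isOpen_inter_preimage hVo hU
  obtain ⟨a, b, hy₀B, hBsub⟩ := exists_ratBox_subset hO
    ⟨hy₀V, show (fun j => ψ j (chartMap T x₀)) ∈ U by rw [hψv₀]; exact hx₀U⟩
  have hGsa : IsSemialgebraicFunOn ℚ (ratBox a b) (fun y => g (fun j => ψ j y)) := by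
    have hmap : IsSemialgebraicMapOn ℚ (ratBox a b) (fun y j => ψ j y) :=
      IsSemialgebraicMapOn.of_forall (isSemialgebraic_ratBox a b) fun j =>
        (hψsa j).mono (fun y hy => (hBsub hy).1) (isSemialgebraic_ratBox a b)
    exact IsSemialgebraicFunOn.comp_isSemialgebraicMapOn_holds hsa hmap
      (fun y hy => (hBsub hy).2)
  have hGan : AnalyticOnNhd ℝ (fun y => g (fun j => ψ j y)) (ratBox a b) := by
    intro y hy
    have hψvan : AnalyticAt ℝ (fun y j => ψ j y) y := AnalyticAt.pi fun j => hψan j y (hBsub hy).1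
    exact (han _ (hBsub hy).2).comp hψvan
  have hce : chartMap T x₀ ∘ e = x₀ ∘ e := by
    funext i
    simp [Function.comp, chartMap, hTe]
  by_cases hgen : AlgebraicIndependent ℚ (chartMap T x₀)
  · exact ⟨1, multiGenData_transport x₀ T hWo hx₀W hleft
      (multiGenData_of_algebraicIndependent (isOpen_ratBox a b) hGsa hGan hy₀B hgen)⟩
  · -- the codimension `d = n - m` is at least `2`
    have hmn : m ≤ n := by
      have := Fintype.card_le_of_injective _ he
      simpa only [Fintype.card_fin] using this
    obtain ⟨d, hd⟩ : ∃ d, m + d = n := ⟨n - m, by omega⟩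
    have hd2 : 2 ≤ d := by
      by_contra hlt
      push Not at hlt
      have hd01 : d = 0 ∨ d = 1 := by omega
      rcases hd01 with rfl | rfl
      · -- codimension 0: the chart point itself is generic
        obtain rfl : m = n := by omega
        have hbij : Function.Bijective e := Finite.injective_iff_bijective.mp he
        let σ := Equiv.ofBijective e hbij
        apply hgen
        have hfun : chartMap T x₀ = (chartMap T x₀ ∘ e) ∘ σ.symm := by
          funext j
          simp only [Function.comp_apply]
          rw [show e (σ.symm j) = j from Equiv.ofBijective_apply_symm_apply e hbij j]
        rw [hfun, hce]
        exact hind.comp _ σ.symm.injective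
      · -- codimension 1: `DefectLeOne x₀`
        obtain rfl : n = m + 1 := by omega
        exact hnot (defectLeOne_of_codim_one x₀ e he hind)
    have hprod : ∃ (m : ℕ) (e : Fin m → Fin n), m + d = n ∧ Function.Injective e ∧
        AlgebraicIndependent ℚ (chartMap T x₀ ∘ e) ∧ ∀ j ∉ Set.range e, chartMap T x₀ j = 0 :=
      ⟨m, e, hd, he, by rw [hce]; exact hind, fun j hj => (hT j hj).1⟩
    obtain ⟨k, hG⟩ := productPointMultiGenCodim_of_sliceNash (hS d hd2 (by omega)) (chartMap T x₀)
      hprod (fun y => g (fun j => ψ j y)) (ratBox a b) (isOpen_ratBox a b) hy₀B hGsa hGan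
    exact ⟨k, multiGenData_transport x₀ T hWo hx₀W hleft hG⟩

/-- **The special stratum from `SliceNash d`, `2 ≤ d ≤ n` only.** -/
theorem multiGenSpecialAt_of_sliceNash_geTwo {n : ℕ} (hS : ∀ d, 2 ≤ d → d ≤ n → SliceNash d) :
    MultiGenSpecialAt n :=
  fun g U hU hKU hsa han x₀ hx₀ hnot =>
    nashGermMultiGen_of_sliceNash_geTwo hS x₀ hnot g U hU (hKU hx₀) hsa han

/-- **Item 33042 `MultiGenSpecial` from `∀ d ≥ 2, SliceNash d`** (no `SliceNash 1` needed): the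
born pair is now `33041 ⟸ SliceNash 1`, `33042 ⟸ ∀ d ≥ 2, SliceNash d` — DISJOINT residuals. -/
theorem item33042_of_sliceNash_geTwo (hS : ∀ d, 2 ≤ d → SliceNash d) : Item33042 :=
  item33042_iff.mpr fun n _ => multiGenSpecialAt_of_sliceNash_geTwo (n := n) fun d hd _ => hS d hd

/-- … and from `∀ d ≥ 2, OriginNash d`. -/
theorem item33042_of_originNash_geTwo (hO : ∀ d, 2 ≤ d → OriginNash d) : Item33042 :=
  item33042_of_sliceNash_geTwo fun d hd => sliceNash_of_originNash (hO d hd)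

/-- NET: item 31659 from the two DISJOINT slice residuals. -/
theorem nashEtaleLocal_of_sliceNash_one_geTwo (h₁ : SliceNash 1) (h₂ : ∀ d, 2 ≤ d → SliceNash d) :
    NashEtaleLocal :=
  nashEtaleLocal_of_items (item33041_of_sliceNash_one h₁) (item33042_of_sliceNash_geTwo h₂)

end SpecialGeTwo
end
end Summit.KontsevichZagierPeriods.RootDecompRationalCubeDichotomy.Rung29430.MultiGen
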